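import Summits.NavierStokesRegularity.NavierStokesRegularity.Theorems.SkeletonEquilibrium.Negative.CurvatureLaws

/-!
# `SkeletonEquilibrium` (stmt-NavierStokesRegularity-15400): the curvature laws every witness obeys, II —
# second order at a waist

Negative-side support for the crux `FilamentSkeletonRss.SkeletonEquilibrium` (leafhand
`leafhand-ns-filamentskeletonrs-21-g0`, 2026-08-31); the second-order companion of the landed
`…Negative.WaistTangentLaw` (`F′(τ*) = (w′(τ*) − ½) T + α e₃ × T` at a stagnation point `w(τ*) = 0`).
Setting as in part I (`…Negative.CurvatureLaws`): `F + V_α(Ξ) = w Ξ′`, `Ξ` unit-speed `C²`, `F`, `w`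
differentiable; route-independent. If in addition `F′` is differentiable at the waist `τ*` with derivative
`F₂` (automatic when `F = u ∘ Ξ` with `u` of class `C²` near the filament — NOT implied by the crux's clauses,
which give `Ξ ∈ C²` only, hence kept as a hypothesis), then, although `w′` is only a derivative, the product
`w′ Ξ′ = F′ − w Ξ″ + V_α(Ξ′)` is differentiable at `τ*` (product rule at a zero of `w`), so `w′` is
differentiable at `τ*` and (`waist_second_deriv_law`)

  `F₂ = w″(τ*) T + (2 w′(τ*) − ½) Ξ″(τ*) + α e₃ × Ξ″(τ*)`,  `T = Ξ′(τ*)`.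

Components and bounds: `waist_curvature_identity` `⟪F₂, Ξ″⟫ = (2w′ − ½) ‖Ξ″‖²`; `waist_binormal_identity`
`⟪F₂, T × Ξ″⟫ = α ⟪e₃, T⟫ ‖Ξ″‖²`; `waist_tangential_identity` `⟪F₂, T⟫ = w″ + α ⟪e₃ × Ξ″, T⟫`;
`waist_curvature_le` `(2w′(τ*) − ½) ‖Ξ″(τ*)‖ ≤ ‖F₂‖` and `waist_curvature_le_of_supercritical`: a
SUPERCRITICAL waist (`w′ ≥ 3/2 + δ`) has curvature `‖Ξ″(τ*)‖ ≤ ‖F₂‖/(5/2 + 2δ)` — supercritical waists are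
flat to second order unless the induced velocity has a large second along-filament derivative there;
`waist_binormal_le` `|α| |⟪e₃, T⟫| ‖Ξ″(τ*)‖ ≤ ‖F₂‖` — a curved waist with non-horizontal tangent (the
near-vertical waists of the negation lines) needs second-order binormal shear when `α ≠ 0`;
`waist_second_budget` `‖Ξ″(τ*)‖² ((2w′ − ½)² + α² ⟪e₃, T⟫²) ≤ ‖F₂‖²` (Bessel for the pair `Ξ″, T × Ξ″`):
a supercritical near-vertical waist of curvature `κ` costs `κ²((5/2 + 2δ)² + α²(1 − θ²)) ≤ ‖(u∘Ξ)″(τ*)‖²`;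
`witness_waist_second_deriv_law` — the same for the crux's own data (any `N, γ, α, Γ`).

Use for both sides of K1: at the waist the curvature is read off from the SECOND along-filament derivative
of the skeleton velocity, `κ(τ*) (2w′(τ*) − ½) = ⟪(u_skel∘Ξ_j)″(τ*), N⟫`; a disproof may trade curvature at a
supercritical waist for bounds on `(u_skel∘Ξ_j)″`, a construction must supply it. No stub of the registered
lines is closed; no summit statement is proved; NS regularity is not touched.
-/

set_option linter.dupNamespace false

namespace Summit.NavierStokesRegularity.NavierStokesRegularity.Theorems.SkeletonEquilibrium.Negative.CurvatureLaws

open Literature.Analysis.FluidPDE MeasureTheory Filter Topology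
open scoped RealInnerProductSpace InnerProductSpace BigOperators

/-! ## 0. Coordinate identities (private copies) -/

/-- `⟪a × b, b⟫ = 0` (private copy). [folklore] -/
private theorem inner_cross_self_right_W (a b : EuclideanSpace ℝ (Fin 3)) : ⟪cross a b, b⟫ = 0 := by
  simp only [cross, PiLp.inner_apply, RCLike.inner_apply, conj_trivial, Fin.sum_univ_three,
    cross_apply, Matrix.cons_val_zero, Matrix.cons_val_one, Matrix.cons_val_two,
    Matrix.head_cons, Matrix.tail_cons]
  ring

/-- `⟪a × b, a⟫ = 0` (private copy). [folklore] -/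
private theorem inner_cross_self_left_W (a b : EuclideanSpace ℝ (Fin 3)) : ⟪cross a b, a⟫ = 0 := by
  simp only [cross, PiLp.inner_apply, RCLike.inner_apply, conj_trivial, Fin.sum_univ_three,
    cross_apply, Matrix.cons_val_zero, Matrix.cons_val_one, Matrix.cons_val_two,
    Matrix.head_cons, Matrix.tail_cons]
  ring

/-- Lagrange's identity `⟪a × b, c × d⟫ = ⟪a, c⟫ ⟪b, d⟫ − ⟪a, d⟫ ⟪b, c⟫` (private copy). [folklore] -/
private theorem inner_cross_cross_W (a b c d : EuclideanSpace ℝ (Fin 3)) :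
    ⟪cross a b, cross c d⟫ = ⟪a, c⟫ * ⟪b, d⟫ - ⟪a, d⟫ * ⟪b, c⟫ := by
  simp only [cross, PiLp.inner_apply, RCLike.inner_apply, conj_trivial, Fin.sum_univ_three,
    cross_apply, Matrix.cons_val_zero, Matrix.cons_val_one, Matrix.cons_val_two,
    Matrix.head_cons, Matrix.tail_cons]
  ring

/-- `‖T × M‖² = ‖T‖² ‖M‖² − ⟪T, M⟫²` (private copy). [folklore] -/
private theorem norm_cross_sq_W (T M : EuclideanSpace ℝ (Fin 3)) :
    ‖cross T M‖ ^ 2 = ‖T‖ ^ 2 * ‖M‖ ^ 2 - ⟪T, M⟫ ^ 2 := by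
  rw [← real_inner_self_eq_norm_sq, inner_cross_cross_W, real_inner_self_eq_norm_sq,
    real_inner_self_eq_norm_sq, real_inner_comm T M]
  ring

/-- Bessel for the orthogonal pair `(M, T × M)` of equal norms: if `‖T‖ = 1`, `⟪T, M⟫ = 0`,
`⟪v, M⟫ = A ‖M‖²` and `⟪v, T × M⟫ = B ‖M‖²`, then `‖M‖² (A² + B²) ≤ ‖v‖²`. [folklore] -/
private theorem bessel_pair_W {T M v : EuclideanSpace ℝ (Fin 3)} {A B : ℝ} (hT : ‖T‖ = 1) (hTM : ⟪T, M⟫ = 0)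
    (hA : ⟪v, M⟫ = A * ‖M‖ ^ 2) (hB : ⟪v, cross T M⟫ = B * ‖M‖ ^ 2) :
    ‖M‖ ^ 2 * (A ^ 2 + B ^ 2) ≤ ‖v‖ ^ 2 := by
  by_cases hM : ‖M‖ = 0
  · rw [hM]; simp only [ne_eq, OfNat.ofNat_ne_zero, not_false_eq_true, zero_pow, zero_mul]; positivity
  have hκ : 0 < ‖M‖ := lt_of_le_of_ne (norm_nonneg _) (Ne.symm hM)
  have hMM : ⟪M, M⟫ = ‖M‖ ^ 2 := real_inner_self_eq_norm_sq M
  have hCC : ⟪cross T M, cross T M⟫ = ‖M‖ ^ 2 := by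
    rw [inner_cross_cross_W, real_inner_self_eq_norm_sq, hT, hMM, real_inner_comm T M, hTM]; ring
  have hMC : ⟪M, cross T M⟫ = 0 := by rw [real_inner_comm]; exact inner_cross_self_right_W _ _
  have hCM : ⟪cross T M, M⟫ = 0 := inner_cross_self_right_W _ _
  set b : Fin 2 → EuclideanSpace ℝ (Fin 3) := ![‖M‖⁻¹ • M, ‖M‖⁻¹ • cross T M] with hb
  have hb0 : b 0 = ‖M‖⁻¹ • M := by simp [hb]
  have hb1 : b 1 = ‖M‖⁻¹ • cross T M := by simp [hb]
  have hinv : ‖M‖⁻¹ * ‖M‖⁻¹ * ‖M‖ ^ 2 = 1 := by field_simp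
  have hon : Orthonormal ℝ b := by
    rw [orthonormal_iff_ite]
    intro i j
    fin_cases i <;> fin_cases j
    · simp only [hb0, real_inner_smul_left, real_inner_smul_right, hMM, Fin.zero_eta, Fin.isValue,
        ↓reduceIte]
      try rw [← mul_assoc, hinv]
    · simp only [hb0, hb1, real_inner_smul_left, real_inner_smul_right, hMC, mul_zero, Fin.zero_eta,
        Fin.isValue, Fin.mk_one, zero_ne_one, ↓reduceIte]
    · simp only [hb0, hb1, real_inner_smul_left, real_inner_smul_right, hCM, mul_zero, Fin.zero_eta,
        Fin.isValue, Fin.mk_one, one_ne_zero, ↓reduceIte]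
    · simp only [hb1, real_inner_smul_left, real_inner_smul_right, hCC, Fin.isValue, Fin.mk_one,
        ↓reduceIte]
      try rw [← mul_assoc, hinv]
  have hbes := hon.sum_inner_products_le v (s := Finset.univ)
  rw [Fin.sum_univ_two, hb0, hb1, real_inner_smul_left, real_inner_smul_left, real_inner_comm,
    hA, real_inner_comm, hB, Real.norm_eq_abs, Real.norm_eq_abs, sq_abs, sq_abs] at hbes
  have h1 : (‖M‖⁻¹ * (A * ‖M‖ ^ 2)) ^ 2 + (‖M‖⁻¹ * (B * ‖M‖ ^ 2)) ^ 2 = ‖M‖ ^ 2 * (A ^ 2 + B ^ 2) := by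
    field_simp
  linarith [h1]

/-! ## 1. Second order at a waist -/

/-- **Second-order waist law.** Let `Ξ` be a unit-speed `C²` curve, `F` and `w` differentiable, with
`F + V_α(Ξ) = w Ξ′`, and let `τ*` be a zero of `w` at which `F′` is differentiable, with derivative `F₂`.
Then `w′` is differentiable at `τ*` and
`F₂ = w″(τ*) Ξ′(τ*) + (2 w′(τ*) − ½) Ξ″(τ*) + α e₃ × Ξ″(τ*)`. [folklore] -/
theorem waist_second_deriv_law {α : ℝ} {Ξ F : ℝ → EuclideanSpace ℝ (Fin 3)} {w : ℝ → ℝ}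
    (hΞ : ContDiff ℝ 2 Ξ) (hunit : ∀ τ, ‖deriv Ξ τ‖ = 1) (hw : Differentiable ℝ w)
    (heq : ∀ τ, F τ + ((1 / 2 : ℝ) • Ξ τ - α • cross (EuclideanSpace.single (2 : Fin 3) (1 : ℝ)) (Ξ τ)) =
      w τ • deriv Ξ τ)
    {τs : ℝ} (hz : w τs = 0) {F₂ : EuclideanSpace ℝ (Fin 3)} (hF2 : HasDerivAt (deriv F) F₂ τs) :
    DifferentiableAt ℝ (deriv w) τs ∧
      F₂ = deriv (deriv w) τs • deriv Ξ τs + (2 * deriv w τs - 1 / 2) • deriv (deriv Ξ) τs +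
        α • cross (EuclideanSpace.single (2 : Fin 3) (1 : ℝ)) (deriv (deriv Ξ) τs) := by
  have hd' : Differentiable ℝ (deriv Ξ) := hΞ.differentiable_deriv_two
  have hc2 : Continuous (deriv (deriv Ξ)) := continuous_deriv_deriv_of_contDiff_two hΞ
  have hFder : ∀ τ, deriv F τ = w τ • deriv (deriv Ξ) τ + deriv w τ • deriv Ξ τ -
      ((1 / 2 : ℝ) • deriv Ξ τ - α • cross (EuclideanSpace.single (2 : Fin 3) (1 : ℝ)) (deriv Ξ τ)) :=
    fun τ => (hasDerivAt_induced hΞ hw heq τ).deriv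
  -- `P := w′ Ξ′ = F′ − w Ξ″ + V_α(Ξ′)` is differentiable at the waist although `w′` is only a derivative
  set P : ℝ → EuclideanSpace ℝ (Fin 3) := fun τ => deriv w τ • deriv Ξ τ with hP
  have hPeq : P = fun τ => deriv F τ - w τ • deriv (deriv Ξ) τ +
      ((1 / 2 : ℝ) • deriv Ξ τ - α • cross (EuclideanSpace.single (2 : Fin 3) (1 : ℝ)) (deriv Ξ τ)) := by
    funext τ; rw [hFder τ]; simp only [hP]; abel
  have hPhas : HasDerivAt P (F₂ - deriv w τs • deriv (deriv Ξ) τs +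
      ((1 / 2 : ℝ) • deriv (deriv Ξ) τs -
        α • cross (EuclideanSpace.single (2 : Fin 3) (1 : ℝ)) (deriv (deriv Ξ) τs))) τs := by
    rw [hPeq]
    exact (hF2.sub (hasDerivAt_smul_of_eq_zero (hw τs).hasDerivAt hz hc2.continuousAt)).add
      (hasDerivAt_lerayDrift (hd' τs).hasDerivAt)
  -- `w′ = ⟪P, Ξ′⟫`, hence differentiable at the waist
  have hw'eq : deriv w = fun τ => ⟪P τ, deriv Ξ τ⟫ := by
    funext τ
    simp only [hP]
    rw [real_inner_smul_left, real_inner_self_eq_norm_sq, hunit τ, one_pow, mul_one]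
  have hw'has : HasDerivAt (deriv w)
      (⟪P τs, deriv (deriv Ξ) τs⟫ + ⟪F₂ - deriv w τs • deriv (deriv Ξ) τs +
        ((1 / 2 : ℝ) • deriv (deriv Ξ) τs -
          α • cross (EuclideanSpace.single (2 : Fin 3) (1 : ℝ)) (deriv (deriv Ξ) τs)), deriv Ξ τs⟫) τs := by
    have h := hPhas.inner ℝ (hd' τs).hasDerivAt
    rw [← hw'eq] at h
    exact h
  have hw'diff : DifferentiableAt ℝ (deriv w) τs := hw'has.differentiableAt
  -- the honest product rule for `P` at the waist, and uniqueness of derivatives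
  have hPhas2 : HasDerivAt P
      (deriv w τs • deriv (deriv Ξ) τs + deriv (deriv w) τs • deriv Ξ τs) τs :=
    hw'diff.hasDerivAt.smul (hd' τs).hasDerivAt
  have huniq := hPhas.unique hPhas2
  refine ⟨hw'diff, ?_⟩
  calc F₂ = (F₂ - deriv w τs • deriv (deriv Ξ) τs +
        ((1 / 2 : ℝ) • deriv (deriv Ξ) τs -
          α • cross (EuclideanSpace.single (2 : Fin 3) (1 : ℝ)) (deriv (deriv Ξ) τs))) +
        deriv w τs • deriv (deriv Ξ) τs -
        ((1 / 2 : ℝ) • deriv (deriv Ξ) τs -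
          α • cross (EuclideanSpace.single (2 : Fin 3) (1 : ℝ)) (deriv (deriv Ξ) τs)) := by module
    _ = (deriv w τs • deriv (deriv Ξ) τs + deriv (deriv w) τs • deriv Ξ τs) +
        deriv w τs • deriv (deriv Ξ) τs -
        ((1 / 2 : ℝ) • deriv (deriv Ξ) τs -
          α • cross (EuclideanSpace.single (2 : Fin 3) (1 : ℝ)) (deriv (deriv Ξ) τs)) := by rw [huniq]
    _ = deriv (deriv w) τs • deriv Ξ τs + (2 * deriv w τs - 1 / 2) • deriv (deriv Ξ) τs +
        α • cross (EuclideanSpace.single (2 : Fin 3) (1 : ℝ)) (deriv (deriv Ξ) τs) := by module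

/-- **Waist curvature identity (normal component).** Under the hypotheses of `waist_second_deriv_law`:
`⟪F₂, Ξ″(τ*)⟫ = (2 w′(τ*) − ½) ‖Ξ″(τ*)‖²`. [folklore] -/
theorem waist_curvature_identity {α : ℝ} {Ξ F : ℝ → EuclideanSpace ℝ (Fin 3)} {w : ℝ → ℝ}
    (hΞ : ContDiff ℝ 2 Ξ) (hunit : ∀ τ, ‖deriv Ξ τ‖ = 1) (hw : Differentiable ℝ w)
    (heq : ∀ τ, F τ + ((1 / 2 : ℝ) • Ξ τ - α • cross (EuclideanSpace.single (2 : Fin 3) (1 : ℝ)) (Ξ τ)) =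
      w τ • deriv Ξ τ)
    {τs : ℝ} (hz : w τs = 0) {F₂ : EuclideanSpace ℝ (Fin 3)} (hF2 : HasDerivAt (deriv F) F₂ τs) :
    ⟪F₂, deriv (deriv Ξ) τs⟫ = (2 * deriv w τs - 1 / 2) * ‖deriv (deriv Ξ) τs‖ ^ 2 := by
  have h := (waist_second_deriv_law hΞ hunit hw heq hz hF2).2
  have hTM : ⟪deriv Ξ τs, deriv (deriv Ξ) τs⟫ = 0 := inner_deriv_deriv_two_eq_zero hΞ hunit τs
  rw [h, inner_add_left, inner_add_left, real_inner_smul_left, real_inner_smul_left,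
    real_inner_smul_left, hTM, inner_cross_self_right_W, real_inner_self_eq_norm_sq]
  ring

/-- **Waist binormal identity.** Under the hypotheses of `waist_second_deriv_law`, with `T = Ξ′(τ*)`:
`⟪F₂, T × Ξ″(τ*)⟫ = α ⟪e₃, T⟫ ‖Ξ″(τ*)‖²`. [folklore] -/
theorem waist_binormal_identity {α : ℝ} {Ξ F : ℝ → EuclideanSpace ℝ (Fin 3)} {w : ℝ → ℝ}
    (hΞ : ContDiff ℝ 2 Ξ) (hunit : ∀ τ, ‖deriv Ξ τ‖ = 1) (hw : Differentiable ℝ w)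
    (heq : ∀ τ, F τ + ((1 / 2 : ℝ) • Ξ τ - α • cross (EuclideanSpace.single (2 : Fin 3) (1 : ℝ)) (Ξ τ)) =
      w τ • deriv Ξ τ)
    {τs : ℝ} (hz : w τs = 0) {F₂ : EuclideanSpace ℝ (Fin 3)} (hF2 : HasDerivAt (deriv F) F₂ τs) :
    ⟪F₂, cross (deriv Ξ τs) (deriv (deriv Ξ) τs)⟫ =
      α * ⟪EuclideanSpace.single (2 : Fin 3) (1 : ℝ), deriv Ξ τs⟫ * ‖deriv (deriv Ξ) τs‖ ^ 2 := by
  have h := (waist_second_deriv_law hΞ hunit hw heq hz hF2).2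
  have hTM : ⟪deriv Ξ τs, deriv (deriv Ξ) τs⟫ = 0 := inner_deriv_deriv_two_eq_zero hΞ hunit τs
  have hM : ⟪deriv (deriv Ξ) τs, cross (deriv Ξ τs) (deriv (deriv Ξ) τs)⟫ = 0 := by
    rw [real_inner_comm]; exact inner_cross_self_right_W _ _
  have hT : ⟪deriv Ξ τs, cross (deriv Ξ τs) (deriv (deriv Ξ) τs)⟫ = 0 := by
    rw [real_inner_comm]; exact inner_cross_self_left_W _ _
  have hMT : ⟪deriv (deriv Ξ) τs, deriv Ξ τs⟫ = 0 := by rw [real_inner_comm]; exact hTM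
  rw [h, inner_add_left, inner_add_left, real_inner_smul_left, real_inner_smul_left,
    real_inner_smul_left, hM, hT, inner_cross_cross_W, real_inner_self_eq_norm_sq, hMT]
  ring

/-- **Waist tangential identity (second order).** Under the hypotheses of `waist_second_deriv_law`:
`⟪F₂, Ξ′(τ*)⟫ = w″(τ*) + α ⟪e₃ × Ξ″(τ*), Ξ′(τ*)⟫`. [folklore] -/
theorem waist_tangential_identity {α : ℝ} {Ξ F : ℝ → EuclideanSpace ℝ (Fin 3)} {w : ℝ → ℝ}
    (hΞ : ContDiff ℝ 2 Ξ) (hunit : ∀ τ, ‖deriv Ξ τ‖ = 1) (hw : Differentiable ℝ w)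
    (heq : ∀ τ, F τ + ((1 / 2 : ℝ) • Ξ τ - α • cross (EuclideanSpace.single (2 : Fin 3) (1 : ℝ)) (Ξ τ)) =
      w τ • deriv Ξ τ)
    {τs : ℝ} (hz : w τs = 0) {F₂ : EuclideanSpace ℝ (Fin 3)} (hF2 : HasDerivAt (deriv F) F₂ τs) :
    ⟪F₂, deriv Ξ τs⟫ = deriv (deriv w) τs +
      α * ⟪cross (EuclideanSpace.single (2 : Fin 3) (1 : ℝ)) (deriv (deriv Ξ) τs), deriv Ξ τs⟫ := by
  have h := (waist_second_deriv_law hΞ hunit hw heq hz hF2).2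
  have hMT : ⟪deriv (deriv Ξ) τs, deriv Ξ τs⟫ = 0 := by
    rw [real_inner_comm]; exact inner_deriv_deriv_two_eq_zero hΞ hunit τs
  have hTT : ⟪deriv Ξ τs, deriv Ξ τs⟫ = 1 := by
    rw [real_inner_self_eq_norm_sq, hunit τs, one_pow]
  rw [h, inner_add_left, inner_add_left, real_inner_smul_left, real_inner_smul_left,
    real_inner_smul_left, hMT, hTT]
  ring

/-- **Waist curvature bound.** Under the hypotheses of `waist_second_deriv_law`:
`(2 w′(τ*) − ½) ‖Ξ″(τ*)‖ ≤ ‖F₂‖` (no sign condition: trivial when `2w′ < ½`). [folklore] -/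
theorem waist_curvature_le {α : ℝ} {Ξ F : ℝ → EuclideanSpace ℝ (Fin 3)} {w : ℝ → ℝ}
    (hΞ : ContDiff ℝ 2 Ξ) (hunit : ∀ τ, ‖deriv Ξ τ‖ = 1) (hw : Differentiable ℝ w)
    (heq : ∀ τ, F τ + ((1 / 2 : ℝ) • Ξ τ - α • cross (EuclideanSpace.single (2 : Fin 3) (1 : ℝ)) (Ξ τ)) =
      w τ • deriv Ξ τ)
    {τs : ℝ} (hz : w τs = 0) {F₂ : EuclideanSpace ℝ (Fin 3)} (hF2 : HasDerivAt (deriv F) F₂ τs) :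
    (2 * deriv w τs - 1 / 2) * ‖deriv (deriv Ξ) τs‖ ≤ ‖F₂‖ := by
  set M := deriv (deriv Ξ) τs with hMdef
  have h := waist_curvature_identity hΞ hunit hw heq hz hF2
  rw [← hMdef] at h
  have h1 : ⟪F₂, M⟫ ≤ ‖F₂‖ * ‖M‖ := real_inner_le_norm _ _
  by_cases hM : ‖M‖ = 0
  · rw [hM, mul_zero]; exact norm_nonneg _
  · have hMpos : 0 < ‖M‖ := lt_of_le_of_ne (norm_nonneg _) (Ne.symm hM)
    have : (2 * deriv w τs - 1 / 2) * ‖M‖ * ‖M‖ ≤ ‖F₂‖ * ‖M‖ := by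
      rw [mul_assoc, ← sq, ← h]; exact h1
    exact le_of_mul_le_mul_right this hMpos

/-- **Supercritical waists are flat to second order.** Under the hypotheses of
`waist_second_deriv_law`, a waist with `3/2 + δ ≤ w′(τ*)` has curvature
`(5/2 + 2δ) ‖Ξ″(τ*)‖ ≤ ‖F₂‖`. [folklore] -/
theorem waist_curvature_le_of_supercritical {α δ : ℝ} {Ξ F : ℝ → EuclideanSpace ℝ (Fin 3)} {w : ℝ → ℝ}
    (hΞ : ContDiff ℝ 2 Ξ) (hunit : ∀ τ, ‖deriv Ξ τ‖ = 1) (hw : Differentiable ℝ w)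
    (heq : ∀ τ, F τ + ((1 / 2 : ℝ) • Ξ τ - α • cross (EuclideanSpace.single (2 : Fin 3) (1 : ℝ)) (Ξ τ)) =
      w τ • deriv Ξ τ)
    {τs : ℝ} (hz : w τs = 0) {F₂ : EuclideanSpace ℝ (Fin 3)} (hF2 : HasDerivAt (deriv F) F₂ τs)
    (hsc : 3 / 2 + δ ≤ deriv w τs) :
    (5 / 2 + 2 * δ) * ‖deriv (deriv Ξ) τs‖ ≤ ‖F₂‖ := by
  have h := waist_curvature_le hΞ hunit hw heq hz hF2
  have h1 : (5 / 2 + 2 * δ) * ‖deriv (deriv Ξ) τs‖ ≤ (2 * deriv w τs - 1 / 2) * ‖deriv (deriv Ξ) τs‖ :=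
    mul_le_mul_of_nonneg_right (by linarith) (norm_nonneg _)
  exact h1.trans h

/-- **Waist binormal bound.** Under the hypotheses of `waist_second_deriv_law`, with `T = Ξ′(τ*)`:
`|α| |⟪e₃, T⟫| ‖Ξ″(τ*)‖ ≤ ‖F₂‖` — a curved waist with non-horizontal tangent (`⟪e₃, T⟫ ≠ 0`, e.g. the
near-vertical waists of the negation lines) needs second-order binormal shear of the induced velocity when
`α ≠ 0`. [folklore] -/
theorem waist_binormal_le {α : ℝ} {Ξ F : ℝ → EuclideanSpace ℝ (Fin 3)} {w : ℝ → ℝ}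
    (hΞ : ContDiff ℝ 2 Ξ) (hunit : ∀ τ, ‖deriv Ξ τ‖ = 1) (hw : Differentiable ℝ w)
    (heq : ∀ τ, F τ + ((1 / 2 : ℝ) • Ξ τ - α • cross (EuclideanSpace.single (2 : Fin 3) (1 : ℝ)) (Ξ τ)) =
      w τ • deriv Ξ τ)
    {τs : ℝ} (hz : w τs = 0) {F₂ : EuclideanSpace ℝ (Fin 3)} (hF2 : HasDerivAt (deriv F) F₂ τs) :
    |α| * |⟪EuclideanSpace.single (2 : Fin 3) (1 : ℝ), deriv Ξ τs⟫| * ‖deriv (deriv Ξ) τs‖ ≤ ‖F₂‖ := by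
  set M := deriv (deriv Ξ) τs with hMdef
  set T := deriv Ξ τs with hTdef
  have h := waist_binormal_identity hΞ hunit hw heq hz hF2
  rw [← hMdef, ← hTdef] at h
  have hTM : ⟪T, M⟫ = 0 := inner_deriv_deriv_two_eq_zero hΞ hunit τs
  have hnorm : ‖cross T M‖ = ‖M‖ := by
    have h2 : ‖cross T M‖ ^ 2 = ‖M‖ ^ 2 := by
      rw [norm_cross_sq_W, hTdef, hunit τs, ← hTdef, hTM]; ring
    exact (sq_eq_sq₀ (norm_nonneg _) (norm_nonneg _)).1 h2
  have h1 : |⟪F₂, cross T M⟫| ≤ ‖F₂‖ * ‖cross T M‖ := abs_real_inner_le_norm _ _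
  rw [h, hnorm, abs_mul, abs_mul, abs_of_nonneg (sq_nonneg ‖M‖)] at h1
  by_cases hM : ‖M‖ = 0
  · rw [hM, mul_zero]; exact norm_nonneg _
  · have hMpos : 0 < ‖M‖ := lt_of_le_of_ne (norm_nonneg _) (Ne.symm hM)
    have : |α| * |⟪EuclideanSpace.single (2 : Fin 3) (1 : ℝ), T⟫| * ‖M‖ * ‖M‖ ≤ ‖F₂‖ * ‖M‖ := by
      rw [mul_assoc, ← sq]; exact h1
    exact le_of_mul_le_mul_right this hMpos

/-- **Second-order waist budget.** Under the hypotheses of `waist_second_deriv_law`, with `T = Ξ′(τ*)`: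
`‖Ξ″(τ*)‖² ((2 w′(τ*) − ½)² + α² ⟪e₃, T⟫²) ≤ ‖F₂‖²` (Bessel for the orthogonal pair `Ξ″`, `T × Ξ″`): a
supercritical (`2w′ − ½ ≥ 5/2 + 2δ`) waist with near-vertical tangent (`⟪e₃, T⟫² ≥ 1 − θ²`) and curvature
`κ` costs `κ² ((5/2 + 2δ)² + α² (1 − θ²)) ≤ ‖F₂‖²`. [folklore] -/
theorem waist_second_budget {α : ℝ} {Ξ F : ℝ → EuclideanSpace ℝ (Fin 3)} {w : ℝ → ℝ}
    (hΞ : ContDiff ℝ 2 Ξ) (hunit : ∀ τ, ‖deriv Ξ τ‖ = 1) (hw : Differentiable ℝ w)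
    (heq : ∀ τ, F τ + ((1 / 2 : ℝ) • Ξ τ - α • cross (EuclideanSpace.single (2 : Fin 3) (1 : ℝ)) (Ξ τ)) =
      w τ • deriv Ξ τ)
    {τs : ℝ} (hz : w τs = 0) {F₂ : EuclideanSpace ℝ (Fin 3)} (hF2 : HasDerivAt (deriv F) F₂ τs) :
    ‖deriv (deriv Ξ) τs‖ ^ 2 * ((2 * deriv w τs - 1 / 2) ^ 2 +
      α ^ 2 * ⟪EuclideanSpace.single (2 : Fin 3) (1 : ℝ), deriv Ξ τs⟫ ^ 2) ≤ ‖F₂‖ ^ 2 := by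
  have hA := waist_curvature_identity hΞ hunit hw heq hz hF2
  have hB : ⟪F₂, cross (deriv Ξ τs) (deriv (deriv Ξ) τs)⟫ =
      (α * ⟪EuclideanSpace.single (2 : Fin 3) (1 : ℝ), deriv Ξ τs⟫) * ‖deriv (deriv Ξ) τs‖ ^ 2 :=
    waist_binormal_identity hΞ hunit hw heq hz hF2
  have h := bessel_pair_W (hunit τs) (inner_deriv_deriv_two_eq_zero hΞ hunit τs) hA hB
  calc ‖deriv (deriv Ξ) τs‖ ^ 2 * ((2 * deriv w τs - 1 / 2) ^ 2 +
        α ^ 2 * ⟪EuclideanSpace.single (2 : Fin 3) (1 : ℝ), deriv Ξ τs⟫ ^ 2)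
      = ‖deriv (deriv Ξ) τs‖ ^ 2 * ((2 * deriv w τs - 1 / 2) ^ 2 +
        (α * ⟪EuclideanSpace.single (2 : Fin 3) (1 : ℝ), deriv Ξ τs⟫) ^ 2) := by ring
    _ ≤ ‖F₂‖ ^ 2 := h

/-! ## 2. The crux's own data -/

/-- **Second-order waist law of a witness.** Same data; at a stagnation point `w_j(τ*) = 0` at which the
skeleton velocity along filament `j` is twice differentiable (hypothesis `hF2`, with second derivative
`F₂`): `w_j′` is differentiable at `τ*` and
`F₂ = w_j″(τ*) Ξ_j′(τ*) + (2 w_j′(τ*) − ½) Ξ_j″(τ*) + α e₃ × Ξ_j″(τ*)`; in particular a supercritical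
waist (`3/2 + δ ≤ w_j′(τ*)`) has `(5/2 + 2δ) ‖Ξ_j″(τ*)‖ ≤ ‖F₂‖`. [folklore] -/
theorem witness_waist_second_deriv_law {N : ℕ} {γ : Fin N → ℝ} {α Γ δ : ℝ}
    {Ξ : Fin N → ℝ → EuclideanSpace ℝ (Fin 3)} {w : Fin N → ℝ → ℝ}
    (hC2 : ∀ j, ContDiff ℝ 2 (Ξ j)) (hunit : ∀ j τ, ‖deriv (Ξ j) τ‖ = 1)
    (hw : ∀ j, Differentiable ℝ (w j))
    (heq : ∀ j τ, (∑ k : Fin N, (Γ * γ k / (4 * Real.pi)) • ∫ σ : ℝ,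
      ((‖Ξ j τ - Ξ k σ‖ ^ 2 + 1) ^ (3 / 2 : ℝ))⁻¹ • cross (deriv (Ξ k) σ) (Ξ j τ - Ξ k σ)) +
      (1 / 2 : ℝ) • Ξ j τ - α • cross (EuclideanSpace.single (2 : Fin 3) (1 : ℝ)) (Ξ j τ) =
      w j τ • deriv (Ξ j) τ)
    {j : Fin N} {τs : ℝ} (hz : w j τs = 0) {F₂ : EuclideanSpace ℝ (Fin 3)}
    (hF2 : HasDerivAt (deriv (fun τ => ∑ k : Fin N, (Γ * γ k / (4 * Real.pi)) • ∫ σ : ℝ,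
      ((‖Ξ j τ - Ξ k σ‖ ^ 2 + 1) ^ (3 / 2 : ℝ))⁻¹ • cross (deriv (Ξ k) σ) (Ξ j τ - Ξ k σ))) F₂ τs)
    (hsc : 3 / 2 + δ ≤ deriv (w j) τs) :
    DifferentiableAt ℝ (deriv (w j)) τs ∧
      F₂ = deriv (deriv (w j)) τs • deriv (Ξ j) τs +
        (2 * deriv (w j) τs - 1 / 2) • deriv (deriv (Ξ j)) τs +
        α • cross (EuclideanSpace.single (2 : Fin 3) (1 : ℝ)) (deriv (deriv (Ξ j)) τs) ∧
      (5 / 2 + 2 * δ) * ‖deriv (deriv (Ξ j)) τs‖ ≤ ‖F₂‖ := by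
  have heq' : ∀ τ, (fun τ => ∑ k : Fin N, (Γ * γ k / (4 * Real.pi)) • ∫ σ : ℝ,
      ((‖Ξ j τ - Ξ k σ‖ ^ 2 + 1) ^ (3 / 2 : ℝ))⁻¹ • cross (deriv (Ξ k) σ) (Ξ j τ - Ξ k σ)) τ +
      ((1 / 2 : ℝ) • Ξ j τ - α • cross (EuclideanSpace.single (2 : Fin 3) (1 : ℝ)) (Ξ j τ)) =
      w j τ • deriv (Ξ j) τ := fun τ => by rw [← heq j τ, add_sub_assoc]
  have h := waist_second_deriv_law (hC2 j) (hunit j) (hw j) heq' hz hF2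
  exact ⟨h.1, h.2, waist_curvature_le_of_supercritical (hC2 j) (hunit j) (hw j) heq' hz hF2 hsc⟩

end Summit.NavierStokesRegularity.NavierStokesRegularity.Theorems.SkeletonEquilibrium.Negative.CurvatureLaws
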